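import Literature.Geometry.Lorentzian.SpacelikeCompleteCovering
import Literature.Geometry.Lorentzian.SpacetimePositiveMassRigidityProofs
import HarnessLib

/-!
# A complete spacelike immersed hypersurface of Minkowski space-time is the graph of a smooth
# function of slope `< 1` over `{t = 0}`

Sequel to `SpacelikeCompleteCovering.lean` (the spatial projection `π ∘ f` of a complete
spacelike immersed hypersurface `f : X → (ℝ⁴, η)`, `f^*η = h` complete, is a homeomorphism onto
`ℝ³`): by the inverse function theorem it is a diffeomorphism `Φ : X ≅ ℝ³`, and `f ∘ Φ⁻¹` is the
graph map of the smooth height function `u = t ∘ f ∘ Φ⁻¹`, whose gradient has norm `< 1`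
everywhere (the graph is spacelike). So complete data which develop into Minkowski space-time —
in particular, by `KIDGlobalImmersion.lean`, complete simply connected data carrying the four
translational KIDs — are, up to diffeomorphism, members of the graph family of
`SpacelikeGraphDevelopment.lean` with pointwise slope `< 1`; they inhabit the conclusion of the
rigid positive energy theorem as soon as the slope is UNIFORMLY `< 1`
(`isCauchyHypersurface_range_of_slope_le` with
`Minkowski.isCauchyHypersurface_range_graph_of_fderiv`), which is what the asymptotic flatness supplies in the printed proof (Beig–Chruściel 1996, §4:
"`i(Σ)` is an asymptotically flat Cauchy surface").

* `InitialDataSet.exists_diffeomorph_graph_of_isComplete` — the diffeomorphism `Φ = π ∘ f`, the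
  smooth height function `u`, `f ∘ Φ⁻¹ = (u, id)`, and `‖∇u‖ < 1`;
* `InitialDataSet.isCauchyHypersurface_range_of_slope_le` — `‖du‖ ≤ θ < 1` ⟹ `f(X)` is a Cauchy
  hypersurface of Minkowski space-time.

Theorems only; no definitions, no named facts.

## References

* R. Beig, P. T. Chruściel, J. Math. Phys. 37 (1996) 1939–1961, proof of Thm. 4.1, §4.
  [BeigChrusciel1996]
* J. M. Lee, *Introduction to Smooth Manifolds*, 2nd ed. (2013), Thm. 4.5 and Ch. 4 (inverse
  function theorem; bijective local diffeomorphisms). [LeeSmoothManifolds2013]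
-/

noncomputable section

open Bundle Set Function Filter Manifold
open scoped Manifold ContDiff Topology RealInnerProductSpace Gradient NNReal

namespace Literature.Geometry.Lorentzian

open Literature.Topology.FourManifolds PseudoRiemannianMetric

namespace InitialDataSet

variable {X : Type*} [TopologicalSpace X] [ChartedSpace E3 X] [IsManifold (𝓡 3) ∞ X]
  [T2Space X] [ConnectedSpace X]
  (D : InitialDataSet (𝓡 3) X) [D.metric.HasLeviCivita]

/-- **A complete spacelike immersed hypersurface of Minkowski space-time is, after a
diffeomorphism of its domain onto `ℝ³`, the entire graph of a smooth function of slope `< 1`.**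
Let `(X, h, k)` be connected `3`-dimensional data with `h` complete and `f : X → (ℝ⁴, η)` a
spacelike immersion with `f^*η = h`. Then the spatial projection `Φ = π ∘ f` is a diffeomorphism
`X ≅ ℝ³` (a bijective local diffeomorphism: `isHomeomorph_spatial_comp_of_isComplete` and the
inverse function theorem), the height function `u = t ∘ f ∘ Φ⁻¹ : ℝ³ → ℝ` is smooth,
`f ∘ Φ⁻¹` is the graph map `y ↦ (u(y), y)`, and `‖∇u‖ < 1` everywhere (the graph is spacelike:
`η(du(w)∂ₜ + w, du(w)∂ₜ + w) = ‖w‖² − ⟪∇u, w⟫² > 0`, take `w = ∇u`). This is the shape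
"`i(Σ)` is the graph of a function over `{t = 0}`" of the embedded slice in the proof of the
rigid positive energy theorem (Beig–Chruściel 1996, §4, last paragraph); the remaining assertion
there, that `i(Σ)` is a Cauchy surface, is the uniform bound `‖∇u‖ ≤ θ < 1`
(`isCauchyHypersurface_range_of_slope_le`), which is where the asymptotic flatness enters.
[cite: BeigChrusciel1996, proof of Thm. 4.1, §4 (last paragraph)] -/
theorem exists_diffeomorph_graph_of_isComplete (hc : D.IsComplete) {f : X → E4}
    (hfi : Minkowski.smoothMetric.toPseudoRiemannianMetric.IsSpacelikeImmersion (𝓡 3) f)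
    (hind : ∀ (x : X) (v w : E3),
      Minkowski.smoothMetric.toPseudoRiemannianMetric.inducedBilin (𝓡 3) f x v w =
        D.h.inner x v w) :
    ∃ (Φ : X ≃ₘ^∞⟮𝓡 3, 𝓘(ℝ, E3)⟯ E3) (u : E3 → ℝ), ContDiff ℝ ∞ u ∧
      (∀ x, Φ x = E4.spatial (f x)) ∧ (∀ y, f (Φ.symm y) = E4.ofTimeSpace (u y) y) ∧
      ∀ y, ‖∇ u y‖ < 1 := by
  have hhom := D.isHomeomorph_spatial_comp_of_isComplete hc hfi hind
  have hfs : ContMDiff (𝓡 3) 𝓘(ℝ, E4) ∞ f := hfi.contMDiff_self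
  set φ : X → E3 := fun x ↦ E4.spatial (f x) with hφ_def
  have hφs : ContMDiff (𝓡 3) 𝓘(ℝ, E3) ∞ φ := E4.spatial.contMDiff.comp hfs
  have hdφ : ∀ x, mfderiv (𝓡 3) 𝓘(ℝ, E3) φ x =
      (E4.spatial : E4 →L[ℝ] E3).comp (mfderiv (𝓡 3) 𝓘(ℝ, E4) f x) := by
    intro x
    rw [show φ = E4.spatial ∘ f from rfl,
      mfderiv_comp x E4.spatial.mdifferentiableAt ((hfs x).mdifferentiableAt (by simp)),
      ContinuousLinearMap.mfderiv_eq]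
    rfl
  have hinj : ∀ x, Injective (mfderiv (𝓡 3) 𝓘(ℝ, E3) φ x) := fun x ↦ by
    rw [hdφ x]
    exact Minkowski.injective_spatial_comp_mfderiv hfi x
  have hinv : ∀ x, (mfderiv (𝓡 3) 𝓘(ℝ, E3) φ x).IsInvertible := fun x ↦
    isInvertible_mfderiv_of_injective (I := 𝓘(ℝ, E3)) (I' := 𝓡 3) rfl (hinj x)
  -- the diffeomorphism `Φ = π ∘ f`
  set Φ : X ≃ₘ^∞⟮𝓡 3, 𝓘(ℝ, E3)⟯ E3 := diffeomorphOfBijectiveOfMfderiv hφs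
    (by exact_mod_cast le_top) hhom.bijective (fun x ↦ (hinv x).choose)
    (fun x ↦ (hinv x).choose_spec.symm) with hΦ_def
  have hΦ : ∀ x, Φ x = E4.spatial (f x) := fun _ ↦ rfl
  -- the height function
  set u : E3 → ℝ := fun y ↦ E4.time (f (Φ.symm y)) with hu_def
  have hGs : ContMDiff 𝓘(ℝ, E3) 𝓘(ℝ, E4) ∞ (fun y ↦ f (Φ.symm y)) := hfs.comp Φ.symm.contMDiff
  have hus : ContDiff ℝ ∞ u := by
    have h1 : ContMDiff 𝓘(ℝ, E3) 𝓘(ℝ, ℝ) ∞ u :=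
      ((EuclideanSpace.proj (0 : Fin 4) : E4 →L[ℝ] ℝ).contMDiff).comp hGs
    exact contMDiff_iff_contDiff.mp h1
  have hgraph : ∀ y, f (Φ.symm y) = E4.ofTimeSpace (u y) y := fun y ↦ by
    have h1 : E4.spatial (f (Φ.symm y)) = y := by rw [← hΦ, Φ.apply_symm_apply]
    conv_lhs => rw [← E4.ofTimeSpace_time_spatial (f (Φ.symm y)), h1]
  refine ⟨Φ, u, hus, hΦ, hgraph, fun y ↦ ?_⟩
  -- slope `< 1`: the graph is spacelike
  have hud : Differentiable ℝ u := hus.differentiable (by simp)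
  have hfun : (fun y ↦ f (Φ.symm y)) = fun y : E3 ↦ E4.ofTimeSpace (u y) y := funext hgraph
  set x := Φ.symm y with hx
  set w : E3 := ∇ u y with hw
  set v : TangentSpace (𝓡 3) x := mfderiv 𝓘(ℝ, E3) (𝓡 3) Φ.symm y w with hv
  have hΦd : MDifferentiableAt 𝓘(ℝ, E3) (𝓡 3) Φ.symm y :=
    (Φ.symm.contMDiff y).mdifferentiableAt (by simp)
  have hdfv : mfderiv (𝓡 3) 𝓘(ℝ, E4) f x v = E4.ofTimeSpace ⟪∇ u y, w⟫ w := by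
    have h1 : mfderiv 𝓘(ℝ, E3) 𝓘(ℝ, E4) (fun y ↦ f (Φ.symm y)) y w =
        mfderiv (𝓡 3) 𝓘(ℝ, E4) f x v := by
      rw [show (fun y ↦ f (Φ.symm y)) = f ∘ Φ.symm from rfl,
        mfderiv_comp y ((hfs _).mdifferentiableAt (by simp)) hΦd]
      rfl
    rw [← h1, hfun, mfderiv_eq_fderiv]
    exact Minkowski.fderiv_graph_apply_eq_gradient (hud y) w
  by_cases hw0 : w = 0
  · rw [hw0, norm_zero]; exact one_pos
  have hv0 : v ≠ 0 := by
    intro hv0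
    have h1 : mfderiv (𝓡 3) 𝓘(ℝ, E3) Φ x (mfderiv 𝓘(ℝ, E3) (𝓡 3) Φ.symm y w) = w := by
      have h2 : mfderiv 𝓘(ℝ, E3) 𝓘(ℝ, E3) (Φ ∘ Φ.symm) y =
          (mfderiv (𝓡 3) 𝓘(ℝ, E3) Φ x).comp (mfderiv 𝓘(ℝ, E3) (𝓡 3) Φ.symm y) :=
        mfderiv_comp y ((Φ.contMDiff _).mdifferentiableAt (by simp)) hΦd
      have h3 : (Φ ∘ Φ.symm : E3 → E3) = id := funext fun y ↦ Φ.apply_symm_apply y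
      rw [h3, mfderiv_id] at h2
      exact (congrArg (fun L ↦ L w) h2).symm
    rw [← hv, hv0, map_zero] at h1
    exact hw0 h1.symm
  have hpos := hfi.2 x v hv0
  rw [inducedBilin_apply, hdfv] at hpos
  change 0 < Minkowski.bilin (E4.ofTimeSpace ⟪∇ u y, w⟫ w) (E4.ofTimeSpace ⟪∇ u y, w⟫ w) at hpos
  rw [Minkowski.bilin_tangent_tangent, ← hw, real_inner_self_eq_norm_sq] at hpos
  -- `0 < ‖w‖² − ‖w‖⁴`, so `‖w‖ < 1`
  have ha : ‖w‖ ^ 2 < 1 := by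
    by_contra hge
    rw [not_lt] at hge
    have := mul_le_mul_of_nonneg_left hge (sq_nonneg ‖w‖)
    linarith
  exact lt_of_pow_lt_pow_left₀ 2 zero_le_one (by rwa [one_pow])

omit [IsManifold (𝓡 3) ∞ X] [T2Space X] [ConnectedSpace X] in
/-- **Cauchy criterion for the developed slice.** If the height function has slope uniformly
bounded away from `1`, `‖du‖ ≤ θ < 1`, then the image `f(X) = {(u(y), y)}` is a Cauchy
hypersurface of Minkowski space-time (`Minkowski.isCauchyHypersurface_range_graph_of_fderiv`,
`SpacetimePositiveMassRigidityProofs.lean`) — the assertion "`i(Σ)` is an asymptotically flat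
Cauchy surface" of Beig–Chruściel 1996, Thm. 4.1, granted the slope bound that the asymptotic
flatness provides. [cite: BeigChrusciel1996, Thm. 4.1 (last sentence)] -/
theorem isCauchyHypersurface_range_of_slope_le {f : X → E4} (Φ : X ≃ₘ^∞⟮𝓡 3, 𝓘(ℝ, E3)⟯ E3)
    {u : E3 → ℝ} (hu : Differentiable ℝ u) (hgraph : ∀ y, f (Φ.symm y) = E4.ofTimeSpace (u y) y)
    {θ : ℝ≥0} (hθ : θ < 1) (hb : ∀ y, ‖fderiv ℝ u y‖₊ ≤ θ) :
    Minkowski.spacetime.metric.IsCauchyHypersurface Minkowski.spacetime.timeOrientation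
      (range (α := Minkowski.spacetime.carrier) f) := by
  have hrange : range (α := Minkowski.spacetime.carrier) f =
      range (α := Minkowski.spacetime.carrier) fun y : E3 ↦ E4.ofTimeSpace (u y) y := by
    ext z
    constructor
    · rintro ⟨x, rfl⟩
      refine ⟨Φ x, ?_⟩
      show E4.ofTimeSpace (u (Φ x)) (Φ x) = f x
      rw [← hgraph, Φ.symm_apply_apply]
    · rintro ⟨y, rfl⟩
      exact ⟨Φ.symm y, hgraph y⟩
  rw [hrange]
  exact Minkowski.isCauchyHypersurface_range_graph_of_fderiv hθ hu hb

end InitialDataSet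

end Literature.Geometry.Lorentzian

end
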